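import Literature.MathematicalPhysics.QuantumFieldTheory.Balaban1983to89.B14DeltaBeta
import Literature.MathematicalPhysics.QuantumFieldTheory.Balaban1983to89.Beta.Assembly
import Literature.MathematicalPhysics.QuantumFieldTheory.Balaban1983to89.Beta.PrefixAbsorption

/-!
# `Balaban1983to89.Beta.PerturbedFamily` — READING (α) AT THE END-STATEMENT LEVEL: the realised family `βᴵ + δ`;
endpoint existence (the [I] Theorem 2 half) AND the [III] list (2.6)–(2.9)/(2.46) along runs, from the β sub-cell's
EVENTUAL data on [I]'s family `βᴵ` + the B14 §3 lineage's CONDITIONAL (Δβ) display + continuity of `δ`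
(cell `pub-balaban`, unit `b2b-balaban-strat-b14` = β sub-cell CO-LEAD, [III] side; node T11.F; census item C14 of
`HOME/MISSING-B14.md` §8 = GAPS G-sb14-4, displayed by the B14 §3 lineage as `B14DeltaBeta` (G-sb14-4-DISPLAY,
G-B14s-23); answer row GAPS C-sb14-14; companion of `B14FlowStepPerturbed`, `B14DeltaBeta`, `Beta.FlowConsumers`,
`Beta.PrefixAbsorption`)

HONEST FRAMING (cell rule, verbatim, page 1 of everything): discharging `BetaPertH` makes Bałaban's UV stability
UNCONDITIONAL — a real constructive-QFT result; it is NOT the continuum limit and NOT the Clay problem.  (Gloss,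
BETA-SPEC v1.8d/v1.9b l. 17–18, GAPS G-ref2-14 (a) / G-ref2-20 (a) / G-ref2-23 (a), verbatim: «UNCONDITIONAL» in
[Balaban1989LargeFieldII] (B16) p. 355's interval-hypothesis sense ONLY (`FlowStepRuns.p355Unconditional_of_partialSums`
keeps `hnodes`); the located leaves G-adv3-2 (left inequality of (0.1)/(2.50), d = 4), G-adv3-1 (U2 transfer of B14
Cor. 3's lower bound) and `SecondExpLeaf` REMAIN.  Gloss 2, BETA-SPEC v1.9e, referee row C-beta-78, BINDING:
«UNCONDITIONAL» = `Beta.Assembly.EventualForm`-unconditional — the END statement with the interval hypothesis removed,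
(0.31) in DEFECTED form on all lattices, admissible couplings shrunk to `g ≤ g⋆`; NOT «[Balaban1987RG1] Theorem 2 as
printed»; never the continuum limit / mass gap / Clay.)  THIS MODULE DISCHARGES NOTHING: every theorem is bookkeeping
over real sequences and over the cell's hypothesis carriers (`FlowStep.HBeta`, `Setup.Flow`, `B12.Construction`,
`Beta.Assembly.EventualForm`, `B14DeltaBeta.CondSmallFC`/`DeltaBoundA`); nothing about Bałaban's β-functions (1.22) or
𝐑-terms is asserted.  ABSOLUTE RULE (cell rule, verbatim): "No internally-minted statement may enter as a cited fact.
Every hypothesis is either kernel-proved in this package or a verbatim quotation of a PUBLISHED theorem with page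
reference. The manuscript(s) under audit are NOT citable for their own disputed steps — they are the thing under
adjudication; programme-internal (2001/route/tribunal) claims are never citable."  Accordingly every β- and δ-input
below is a HYPOTHESIS BINDER (eventual lower bound, conditional smallness, continuity), none is a cited fact.

CITATION HEADER (lean-in-tree rule).  T. Bałaban, *Renormalization group approach to lattice gauge field theories. I*,
Commun. Math. Phys. **109**, 249–301 (1987) [Balaban1987RG1] = [I] (cell paper B12; journal page = PDF page + 248;
render `HOME/b2b-balaban-ref1/pages/1987-cmp109-rg-I-small-field/…-p011-x2.png` READ as an image by this seat,
2026-08-18), p. 259 [11]: *"The second concerns the behavior of the sequence of the effective coupling constants g_k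
generated from the bare coupling constant g₀ by the renormalization group equations (0.18), (0.20)."*; Theorem 2:
*"Let d = 4, G = SU(2), and let γ be a sufficiently small positive constant, then for a sufficiently small positive g
there exists a bare coupling constant g₀ = g₀(ε, g) such that the sequence of the effective coupling constants g_k is
contained in the interval ]0, γ], and g_K = g."* (the ENDPOINT-EXISTENCE half, typed by the carver as
`DagBinding.EndpointExistence`; *"A proof of this theorem, based on perturbative calculations, will be given in a
separate paper"* — UNPRINTED, under adjudication, never a `theorem` here).  T. Bałaban, *Convergent renormalization
expansions for lattice gauge theories*, Commun. Math. Phys. **119**, 243–285 (1988) [Balaban1988Convergent] = [III]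
(cell paper B14; journal page = PDF page + 242; renders `…/1988-cmp119-convergent-renormalization-p013-x2.png`,
`…-p017-x2.png`, `…-p029-x2.png` READ as images by this seat), p. 255 [13], after (2.6): *"where n > m, and β₀ > 0 can
be chosen arbitrarily small, if g is sufficiently small. The inequalities follow from the renormalization group
equations (0.20) [I], and from the properties of the β-functions."*; p. 259 [17]: *"The term 𝐑_k arises as the effect
of the 𝐑-operations, and has localization properties similar to those of the term 𝐄_k. For this term we perform the
vacuum energy renormalization only."*, and after (2.24): *"Here the coupling constants g_{j−1} are defined as in
(I.0.20)"*; p. 271 [29]: *"Therefore the expression determined by the sum 𝐑′_k = Σ_{j=1}^{k₁} 𝐑^{(j)} is Euclidean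
covariant with respect to the Euclidean transformations leaving invariant the lattice T^{(k+1)}. It has the same
covariance property as the expression determined by 𝐄_k, and we include it into 𝐄_k. The sum of the two expressions,
𝐑′_k and 𝐄_k, is denoted also by 𝐄_k. The sum of the remaining terms 𝐑″_k = Σ_{j=k₁+1}^{k} 𝐑^{(j)} is treated
separately."*  WHAT IS REPRODUCED: nothing of either paper is re-proved; the module records, at statement level, what
the cell's located reading (α) of these sentences costs on the flow side, on BOTH sides of the END statement.

THE POINT SETTLED (census item C14, consumer side).  Under READING (α) (GAPS G-B14s-22 §4 / G-sb14-4: B14's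
`β_{k+1}` in (2.24) IS (I.1.20)–(I.1.22) of B14's own family built from the merged `𝐄_k ⊇ 𝐑′_k`, p. 271), the
REALISED family of the construction is `β = βᴵ + δ` — `βᴵ` = [I]'s (1.22) family (the β sub-cell's object, target
`Beta.Assembly.EventualForm βᴵ`), `δ` = the 𝐑′-generated perturbation, HISTORY-dependent (`FlowStep.HBeta`:
`δ_{k+1}(g_0,…,g_k)`), on which print displays NO bound; the B14 §3 lineage's display `B14DeltaBeta` (pv02 gen 5) types
the honest interface as CONDITIONAL smallness `CondSmallFC` — *the printed flow facts (2.6)–(2.9) ∧ (2.46) up to the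
horizon k ⇒ |δ_k| ≤ θ* — and proves the run-level bootstrap (`flowControl_of_condSmallFC`) given (AvAF) for the
[I]-part.  TWO things were left: (a) the [III] list along runs at the END-statement (history/world) typing level from
the sub-cell's EVENTUAL data on `βᴵ` (not (AvAF) as a run hypothesis) — §2; (b) the [I]-SIDE SHOOTING (endpoint
existence) for the REALISED family: the cell's shooting theorems (`FlowStepRuns.couplingTrajectory_exists_partialSums`,
`endpointExistence_of_partialSums`) consume BOX-WIDE hypotheses (partial sums of `β` bounded below on ALL histories in
`]0,γ₀]^{k+1}`, continuity), which a merely CONDITIONALLY bounded `δ` does not supply.  §3–§4 close (b) by a CLAMP: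
`β̂ := βᴵ + max(−b/2, min(b/2, δ))` HAS box-wide bounds, so the shooting applies to `β̂`; along the (0.20)-trajectory of
`β̂` so produced (in `]0,γ]`) the realised values obey the clamped bounds, hence (§1) the flow facts hold at EVERY
horizon, hence the conditional smallness fires, `|δ_k| ≤ b/2`, the clamp is INACTIVE, the trajectory solves (0.20)
for `β` itself, and forward uniqueness (`FlowStepRuns.flow_eq_of_rgEqH`) identifies it with the construction's run.
CONSEQUENCE (§5, `endpoint_and_flowControl_of_eventualForm`): under reading (α) the END-statement-grade flow input is
EXACTLY `EventualForm βᴵ` (the sub-cell's unchanged target for [I]'s family) + the conditional (Δβ) display lifted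
to histories + joint continuity of `δ` on the boxes (printed nowhere; `B14DeltaBeta.betaContH_of_split`) — nothing
else; with the (Δβ-a) grade of the reconstruction as the source, the extra smallness is the pure-γ condition
`D_a·γ^{κ−6} ≤ b/2` (`endpoint_and_flowControl_of_boundAH`).  So C14 adds NO β-function input to the sub-cell's wall
and NO run-level hypothesis beyond the B14 §3 lineage's own undisplayed estimate; reading (β) was already flow-neutral
(`B14FlowStepPerturbed.rebooked_le_of_sum246`).  NOT CLAIMED: that (Δβ-a) holds (NOT PRINTED, asserted by nobody),
that `δ` is continuous (printed nowhere), anything about (AF-0).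

WHAT IS PROVED HERE (all `[folklore]` real-sequence / order bookkeeping unless a display is named):
0. `smallnessFor_of_le`, `polySmall_of_le`, `defect_of_le`: the smallness package shrinks with `γ` (one threshold
   `γ₁` serves every `γ ≤ γ₁`, as the quantifier prefix of `EndpointExistence` demands).
1. `horizonFacts_of_realisedBounds` (run level): realised values in `[−(β′+b/2), β′+b/2]` with tail `≥ b/2` from
   `k₀` on ⇒ `B14DeltaBeta.HorizonFacts` at EVERY horizon `k ≤ K` (`B14FlowStep.flowControl_of_eventualLower`).
2. `flowControl_along_of_condSmall` (world level, [III] side): construction generated by `β = βᴵ + δ`, eventual data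
   on `βᴵ`, `CondSmallFC` for `δ` realised along the run ⇒ (2.6)–(2.9) (constant `β′+b/2`) ∧ (2.46) at the horizon
   `K` of every in-interval run (pv02's bootstrap through `FlowStepRuns.realised_eq_hist`).
3. `exists_clamped` (the clamp and its five properties), `exists_curriedFlow` (carrier).
4. `endpointRun_of_condSmallH` (v1.1; world level, [I] side): from eventual data on `βᴵ`, continuity of `βᴵ, δ`,
   HISTORY-WISE conditional smallness of `δ` and one smallness threshold — for every `m`, `γ ≤ min(γ₀,γ₁)`,
   `g` with `1/γ² + (β′+b/2)k₀ ≤ 1/g²` and every `K`, a bare coupling whose run stays in `]0,γ]`, ends at `g_K = g` and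
   obeys the DEFECTED two-sided running `1/g² + (b/2)(K−k) − (b+β′)k₀ ≤ 1/g_k² ≤ 1/g² + (β′+b/2)(K−k)`,
   `1/g² − (β′+b/2)k₀ ≤ 1/g_k²` (the reading-(α) counterpart of `PrefixAbsorption.thm2Defected_of_eventualForm`);
   `endpointExistence_of_condSmallH`: hence `DagBinding.EndpointExistence C`, `g⋆ = (1/γ² + (β′+b/2)k₀)^{−1/2}`.
5. `endpoint_and_flowControl_of_condSmallH` (both halves), `…_of_eventualForm` (`EventualForm βᴵ`-bundled),
   `condSmallH_of_boundAH` + `endpoint_and_flowControl_of_boundAH` ((Δβ-a) history-wise, pure-γ smallness).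
6. `condSmallH_of_zero`, `endpoint_and_flowControl_unperturbed`: non-vacuity / the `δ ≡ 0` special case
   (= `EventualForm.endpointExistence` + `FlowConsumers.eventualForm_flowControl_along` up to the constant `β′+b/2`).

Imports `B14DeltaBeta` (→ `B14FlowStepPerturbed`, `B14FlowStep`, `B12Beta`, `FlowStep`), `Beta.Assembly`
(→ `FlowStepRuns`, `DagBinding`) and (v1.1) `Beta.PrefixAbsorption` (for `defected031_of_eventualLower`); restates nothing
of them.  Mathlib only otherwise; 0 `def`, 0 `sorry`, no `axiom`.  Versions: v1 p181006 (2026-08-18); v1.1: +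
`endpointRun_of_condSmallH` (the defected (0.31) along the endpoint runs), `endpointExistence_of_condSmallH` re-derived
from it (statement unchanged), every other declaration byte-identical; docstring advisories A1–A3 of the cross-read
(cell referee row C-ref6-64: one `[cite:]` tag per source; D-sb14.6 named at `hcs`; the `γ⋆ ≤ 1` clause) applied.
Cell prose: `HOME/MISSING-B14.md` v8 §8 C14, `HOME/BETA-SPEC.md` §5.11, GAPS C-sb14-14.
-/

namespace Literature.MathematicalPhysics.QuantumFieldTheory.Balaban1983to89.Beta.PerturbedFamily

open Literature.MathematicalPhysics.QuantumFieldTheory.Balaban1983to89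
open Literature.MathematicalPhysics.QuantumFieldTheory.Balaban1983to89.FlowStep
open Literature.MathematicalPhysics.QuantumFieldTheory.Balaban1983to89.DagBinding
open Literature.MathematicalPhysics.QuantumFieldTheory.Balaban1983to89.FlowStepRuns
open Literature.MathematicalPhysics.QuantumFieldTheory.Balaban1983to89.B14DeltaBeta
open Literature.MathematicalPhysics.QuantumFieldTheory.Balaban1983to89.B14FlowStepPerturbed
open Literature.MathematicalPhysics.QuantumFieldTheory.Balaban1983to89.Beta.Assembly
open Literature.MathematicalPhysics.QuantumFieldTheory.Balaban1983to89.Beta.PrefixAbsorption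

noncomputable section

/-! ## 0. Smallness is monotone in `γ` (so ONE threshold serves every `γ` below it, as `EndpointExistence` asks) -/

/-- `SmallnessFor` shrinks with `γ`. [folklore] -/
theorem smallnessFor_of_le {γ γ₁ β' β₀ : ℝ} {L p : ℕ} (S : B14FlowStep.SmallnessFor γ₁ β' β₀ L p)
    (hγ : 0 < γ) (hle : γ ≤ γ₁) : B14FlowStep.SmallnessFor γ β' β₀ L p := by
  have hsq : γ ^ 2 ≤ γ₁ ^ 2 := pow_le_pow_left₀ hγ.le hle 2
  have hγ2 : 0 < γ ^ 2 := pow_pos hγ 2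
  have hlog : Real.log (γ₁ ^ 2)⁻¹ ≤ Real.log (γ ^ 2)⁻¹ :=
    Real.log_le_log (inv_pos.mpr (pow_pos S.γ_pos 2)) (inv_anti₀ hγ2 hsq)
  exact
    { γ_pos := hγ
      γ_lt_one := lt_of_le_of_lt hle S.γ_lt_one
      β'_nonneg := S.β'_nonneg
      β₀_pos := S.β₀_pos
      β₀_le_one := S.β₀_le_one
      h26c := (mul_le_mul_of_nonneg_right hsq S.β'_nonneg).trans S.h26c
      h27c := (mul_le_mul_of_nonneg_right hsq S.β'_nonneg).trans S.h27c
      h27a := S.h27a.trans hlog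
      h27b := S.h27b.trans (mul_le_mul_of_nonneg_left hlog S.β₀_pos.le)
      hL := S.hL
      h29c := S.h29c }

/-- The polynomial γ-smallness of `B14FlowStep.flowControl_of_avgAF` shrinks with `γ`. [folklore] -/
theorem polySmall_of_le {γ γ₁ s : ℝ} {κ : ℕ} (hs : 0 < s) (hγ : 0 ≤ γ) (hle : γ ≤ γ₁)
    (h : Real.sqrt 2 ^ (κ - 6) * (2 * γ₁ ^ 4 / s + γ₁ ^ 6) < 1) :
    Real.sqrt 2 ^ (κ - 6) * (2 * γ ^ 4 / s + γ ^ 6) < 1 := by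
  have h4 : γ ^ 4 ≤ γ₁ ^ 4 := pow_le_pow_left₀ hγ hle 4
  have h6 : γ ^ 6 ≤ γ₁ ^ 6 := pow_le_pow_left₀ hγ hle 6
  have hsq : 0 ≤ Real.sqrt 2 ^ (κ - 6) := pow_nonneg (Real.sqrt_nonneg _) _
  have hmono : 2 * γ ^ 4 / s + γ ^ 6 ≤ 2 * γ₁ ^ 4 / s + γ₁ ^ 6 := by
    have h1 : 2 * γ ^ 4 / s ≤ 2 * γ₁ ^ 4 / s := by
      apply div_le_div_of_nonneg_right _ hs.le
      linarith
    linarith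
  exact lt_of_le_of_lt (mul_le_mul_of_nonneg_left hmono hsq) h

/-- A defect quadratic in `γ` shrinks with `γ`. [folklore] -/
theorem defect_of_le {γ γ₁ B c : ℝ} (hB : 0 ≤ B) (hγ : 0 ≤ γ) (hle : γ ≤ γ₁) (h : B * γ₁ ^ 2 ≤ c) :
    B * γ ^ 2 ≤ c :=
  (mul_le_mul_of_nonneg_left (pow_le_pow_left₀ hγ hle 2) hB).trans h

/-! ## 1. Run level: the [III] list at EVERY horizon from two-sided realised bounds with an eventual tail -/

/-- Along a flow solving (0.20) in `]0,γ]` whose realised β-values satisfy `−(β′+b/2) ≤ β_{j+1}(g_j) ≤ β′+b/2` for all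
`j < K` and `β_{j+1}(g_j) ≥ b/2` for `k₀ ≤ j < K`, with `SmallnessFor γ (β′+b/2) β₀ L p` and the γ-smallness of the
defect `(b+β′)k₀`: at EVERY horizon `k ≤ K` the printed flow facts (2.6), (2.7), (2.8), (2.9) (constant `β′+b/2`) and
the middle member of (2.46) hold (`B14DeltaBeta.HorizonFacts`) — `B14FlowStep.flowControl_of_eventualLower` at the
horizon `k`.  Used below for the CLAMPED family, whose realised values obey these bounds by construction.
[cite: Balaban1988Convergent, (2.6)–(2.9) pp.255–256 and (2.46) p.263] -/
theorem horizonFacts_of_realisedBounds (F : Flow) (K : ℕ) {γ b β' β₀ A₀ : ℝ} {L p k₀ κ : ℕ}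
    (Sm : B14FlowStep.SmallnessFor γ (β' + b / 2) β₀ L p) (hA₀ : 0 ≤ A₀)
    (R : ℕ → ℕ) (hR : ∀ j, j ≤ K → B14.IsRj L p (F.g j) (R j))
    (hrg : F.SatisfiesRG K) (hI : F.InInterval γ K) (hb : 0 < b)
    (hub : ∀ j, j < K → F.β (j + 1) (F.g j) ≤ β' + b / 2)
    (hlo : ∀ j, j < K → -(β' + b / 2) ≤ F.β (j + 1) (F.g j))
    (htail : ∀ j, k₀ ≤ j → j < K → b / 2 ≤ F.β (j + 1) (F.g j))
    (hBγ : (b + β') * k₀ * γ ^ 2 ≤ β₀ * (2 + β₀)) (hBγ' : (b + β') * k₀ * γ ^ 2 ≤ 1 / 2) (hκ : 6 ≤ κ)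
    (hsmall : Real.sqrt 2 ^ (κ - 6) * (2 * γ ^ 4 / (b / 2) + γ ^ 6) < 1) :
    ∀ k, k ≤ K → HorizonFacts F (β' + b / 2) β₀ A₀ L p κ R k := by
  intro k hk
  have e : (b / 2 + (β' + b / 2)) * (k₀ : ℝ) * γ ^ 2 = (b + β') * k₀ * γ ^ 2 := by ring
  exact B14FlowStep.flowControl_of_eventualLower F k Sm hA₀ (k₀ := k₀) R (fun j hj => hR j (hj.trans hk))
    (fun j hj => hrg j (lt_of_lt_of_le hj hk)) (fun j hj => hI j (hj.trans hk))
    (fun j hj => hub j (lt_of_lt_of_le hj hk)) (fun j hj => hlo j (lt_of_lt_of_le hj hk)) (half_pos hb)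
    (fun j hj0 hj => htail j hj0 (lt_of_lt_of_le hj hk)) (by rw [e]; exact hBγ) (by rw [e]; exact hBγ') hκ hsmall

/-! ## 2. World level, reading (α): the [III] list along in-interval runs from EVENTUAL data on `βᴵ` and the
CONDITIONAL smallness of `δ` realised along the run -/

/-- **The [III]-side consumer list under reading (α), along runs.**  Let the construction `C` be generated forward by
(0.20) with the REALISED family `β`, halting outside, its run-wise β-functions currying `β`; let `β = βᴵ + δ` on the
boxes `]0,γ₀]^{k+1}` (reading (α): `βᴵ` = [I]'s (1.22) family, `δ` = the 𝐑′-generated perturbation typed in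
`B14DeltaBeta`); let `βᴵ` carry the β sub-cell's EVENTUAL data — `βᴵ_{k+1} ≥ b > 0` on the boxes for `k ≥ k₀`, the
printed two-sided bound `−β′ ≤ βᴵ ≤ β′`; and let the realised values `δ_k(g_0,…,g_k)` ALONG THE RUN satisfy the B14 §3
lineage's conditional interface `CondSmallFC` (flow facts up to the horizon `k` ⇒ `|δ_k| ≤ b/2`).  Then, with
`SmallnessFor γ (β′+b/2) β₀ L p`, `γ ≤ γ₀` and the γ-smallness of the defect `(b+β′)k₀`, along every run staying in
`]0,γ]` up to `K`: ALL of (2.6)–(2.9) (constant `β′+b/2`) and (2.46).  (pv02's bootstrap `flowControl_of_condSmallFC`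
read through the run-wise dictionary `FlowStepRuns.realised_eq_hist`, (AvAF) for the [I]-part from the eventual data by
`B14FlowStepPerturbed.avgAF_seq_of_eventualLower`.) [cite: Balaban1988Convergent, (2.6)–(2.9) pp.255–256, (2.46) p.263, p.259, p.271, p.278] -/
theorem flowControl_along_of_condSmall {C : B12.Construction} {β βI δ : HBeta}
    (hgen : ForwardGenerated C β) (hhalt : HaltsOutside C β) (hcur : CurriesHBeta C β)
    {γ₀ : ℝ} (hsplit : ∀ k, ∀ v ∈ Box γ₀ k, β k v = βI k v + δ k v)
    {γ b β' β₀ A₀ : ℝ} {L p k₀ κ : ℕ} (Sm : B14FlowStep.SmallnessFor γ (β' + b / 2) β₀ L p) (hA₀ : 0 ≤ A₀)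
    (hγ₀ : γ ≤ γ₀) (hb : 0 < b) (hβ' : 0 ≤ β')
    (htail : ∀ k, k₀ ≤ k → ∀ v ∈ Box γ₀ k, b ≤ βI k v)
    (hlo : ∀ k, ∀ v ∈ Box γ₀ k, -β' ≤ βI k v) (hup : BetaUpperH β' γ₀ βI)
    (hBγ : (b + β') * k₀ * γ ^ 2 ≤ β₀ * (2 + β₀)) (hBγ' : (b + β') * k₀ * γ ^ 2 ≤ 1 / 2) (hκ : 6 ≤ κ)
    (hsmall : Real.sqrt 2 ^ (κ - 6) * (2 * γ ^ 4 / (b / 2) + γ ^ 6) < 1)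
    (P : B12.RunParams) (hI : (C P).flow.InInterval γ P.K)
    (R : ℕ → ℕ) (hR : ∀ j, j ≤ P.K → B14.IsRj L p ((C P).flow.g j) (R j))
    (hcs : CondSmallFC (C P).flow (β' + b / 2) β₀ A₀ L p κ R
      (fun k => δ k (prefixOf (C P).flow.g k)) P.K (b / 2)) :
    HorizonFacts (C P).flow (β' + b / 2) β₀ A₀ L p κ R P.K := by
  have hrg : (C P).flow.SatisfiesRG P.K := satisfiesRG_of_inInterval hgen hhalt hcur P hI
  have hsplit' : ∀ j, j < P.K → (C P).flow.β (j + 1) ((C P).flow.g j)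
      = βI j (prefixOf (C P).flow.g j) + δ j (prefixOf (C P).flow.g j) := by
    intro j hj
    obtain ⟨hpt, hbox⟩ := realised_eq_hist hcur P hγ₀ hI hj
    rw [hpt]; exact hsplit j _ hbox
  have hubI : ∀ j, j < P.K → βI j (prefixOf (C P).flow.g j) ≤ β' := fun j hj =>
    hup j _ (realised_eq_hist hcur P hγ₀ hI hj).2
  have hloI : ∀ j, j < P.K → -β' ≤ βI j (prefixOf (C P).flow.g j) := fun j hj =>
    hlo j _ (realised_eq_hist hcur P hγ₀ hI hj).2
  have htailI : ∀ j, k₀ ≤ j → j < P.K → b ≤ βI j (prefixOf (C P).flow.g j) := fun j hk hj =>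
    htail j hk _ (realised_eq_hist hcur P hγ₀ hI hj).2
  have havI := avgAF_seq_of_eventualLower P.K (fun j => βI j (prefixOf (C P).flow.g j)) hβ' hb.le hloI htailI
  exact flowControl_of_condSmallFC (C P).flow P.K Sm hA₀ R hR
    (fun j => βI j (prefixOf (C P).flow.g j)) (fun k => δ k (prefixOf (C P).flow.g k))
    hrg hI hsplit' hubI hb havI hcs hκ hBγ hBγ' hsmall

/-! ## 3. The CLAMP: a family with BOX-WIDE eventual bounds that agrees with `β` wherever `|δ| ≤ b/2` -/

/-- **The clamped family.**  For `β = βᴵ + δ` on the boxes with the eventual data on `βᴵ` and joint continuity of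
`βᴵ` and `δ`, the family `β̂ := βᴵ + max(−b/2, min(b/2, δ))` is jointly continuous on the boxes, satisfies the
BOX-WIDE bounds `−(β′+b/2) ≤ β̂ ≤ β′+b/2` and `β̂_{k+1} ≥ b/2` for `k ≥ k₀`, and COINCIDES with `β` at every box history
where `|δ| ≤ b/2`.  (So the B12-side shooting, which consumes box-wide hypotheses, applies to `β̂`; §4 shows that the
trajectories it produces never see the clamp.)  Elementary; asserts nothing about Bałaban's functions. [folklore] -/
theorem exists_clamped {β βI δ : HBeta} {γ₀ b β' : ℝ} {k₀ : ℕ} (hb : 0 < b)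
    (hsplit : ∀ k, ∀ v ∈ Box γ₀ k, β k v = βI k v + δ k v)
    (htail : ∀ k, k₀ ≤ k → ∀ v ∈ Box γ₀ k, b ≤ βI k v)
    (hlo : ∀ k, ∀ v ∈ Box γ₀ k, -β' ≤ βI k v) (hup : BetaUpperH β' γ₀ βI)
    (hcontI : BetaContH γ₀ βI) (hcontδ : BetaContH γ₀ δ) :
    ∃ βc : HBeta, BetaContH γ₀ βc ∧ BetaUpperH (β' + b / 2) γ₀ βc ∧
      (∀ k, ∀ v ∈ Box γ₀ k, -(β' + b / 2) ≤ βc k v) ∧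
      (∀ k, k₀ ≤ k → ∀ v ∈ Box γ₀ k, b / 2 ≤ βc k v) ∧
      (∀ k, ∀ v ∈ Box γ₀ k, |δ k v| ≤ b / 2 → βc k v = β k v) := by
  refine ⟨fun k v => βI k v + max (-(b / 2)) (min (b / 2) (δ k v)), ?_, ?_, ?_, ?_, ?_⟩
  · intro k
    have hcl : Continuous fun t : ℝ => max (-(b / 2)) (min (b / 2) t) :=
      continuous_const.max (continuous_const.min continuous_id)
    exact (hcontI k).add (hcl.comp_continuousOn (hcontδ k))
  · intro k v hv
    have h1 : max (-(b / 2)) (min (b / 2) (δ k v)) ≤ b / 2 := max_le (by linarith) (min_le_left _ _)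
    have h2 := hup k v hv
    show βI k v + max (-(b / 2)) (min (b / 2) (δ k v)) ≤ β' + b / 2
    linarith
  · intro k v hv
    have h1 : -(b / 2) ≤ max (-(b / 2)) (min (b / 2) (δ k v)) := le_max_left _ _
    have h2 := hlo k v hv
    show -(β' + b / 2) ≤ βI k v + max (-(b / 2)) (min (b / 2) (δ k v))
    linarith
  · intro k hk v hv
    have h1 : -(b / 2) ≤ max (-(b / 2)) (min (b / 2) (δ k v)) := le_max_left _ _
    have h2 := htail k hk v hv
    show b / 2 ≤ βI k v + max (-(b / 2)) (min (b / 2) (δ k v))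
    linarith
  · intro k v hv hδ
    have h1 : min (b / 2) (δ k v) = δ k v := min_eq_right (abs_le.mp hδ).2
    have h2 : max (-(b / 2)) (δ k v) = δ k v := max_eq_right (abs_le.mp hδ).1
    show βI k v + max (-(b / 2)) (min (b / 2) (δ k v)) = β k v
    rw [h1, h2, hsplit k v hv]

/-- A flow carrying a prescribed coupling sequence with a prescribed history family curried along it (the carrier
shape of `FlowStepRuns.genFlow`, for an arbitrary sequence). [folklore] -/
theorem exists_curriedFlow (βc : HBeta) (gs : ℕ → ℝ) :
    ∃ F : Flow, F.g = gs ∧ ∀ j x, F.β (j + 1) x = βc j (Function.update (prefixOf gs j) (Fin.last j) x) :=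
  ⟨⟨gs, fun j x => match j with
      | 0 => 0
      | j + 1 => βc j (Function.update (prefixOf gs j) (Fin.last j) x)⟩, rfl, fun _ _ => rfl⟩

/-! ## 4. World level, reading (α): the B12-side ENDPOINT EXISTENCE from eventual data on `βᴵ`, continuity of `δ`,
and the HISTORY-WISE conditional smallness of `δ` -/

/-- **The endpoint RUN under reading (α), with the DEFECTED two-sided running (0.31) along it** (the reading-(α)
counterpart of `PrefixAbsorption.thm2Defected_of_eventualForm`; v1.1).  Hypotheses as in `endpointExistence_of_condSmallH`
below (minus `0 < γ₀`, not needed at fixed `γ`).  For every `m`, every `γ ≤ min(γ₀,γ₁)`, every renormalised `g > 0` with `1/γ² + (β′+b/2)k₀ ≤ 1/g²` and EVERY `K`: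
a bare coupling whose run stays in `]0,γ]`, ends at `g_K = g`, and satisfies for all `k ≤ K`
`1/g² + (b/2)(K−k) − (b+β′)k₀ ≤ 1/g_k²`, `1/g² − (β′+b/2)k₀ ≤ 1/g_k²`, `1/g_k² ≤ 1/g² + (β′+b/2)(K−k)` — the printed
(0.31) shape `1/g² + β log(L^kε)^{−1} ≤ 1/g_k² ≤ 1/g² + β′ log(L^kε)^{−1}` per step with an ADDITIVE DEFECT in the lower
half (a cell WEAKENING of (0.31), DIVERGENCE D-sb14.5, not a reading of it).  PROOF = the clamp trick (docstring of
`endpointExistence_of_condSmallH`) + `PrefixAbsorption.defected031_of_eventualLower` along the clamped trajectory, whose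
realised values lie in `[−(β′+b/2), β′+b/2]` with tail `≥ b/2`.
[cite: Balaban1987RG1, Thm 2 p.259 with (0.31), (0.20) p.256] [cite: Balaban1988Convergent, p.259, p.271, p.278] -/
theorem endpointRun_of_condSmallH {C : B12.Construction} {β βI δ : HBeta}
    (hgen : ForwardGenerated C β) {γ₀ : ℝ}
    (hsplit : ∀ k, ∀ v ∈ Box γ₀ k, β k v = βI k v + δ k v)
    {γ₁ b β' β₀ A₀ : ℝ} {L p k₀ κ : ℕ} (Sm : B14FlowStep.SmallnessFor γ₁ (β' + b / 2) β₀ L p) (hA₀ : 0 ≤ A₀)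
    (hb : 0 < b) (hβ' : 0 ≤ β')
    (htail : ∀ k, k₀ ≤ k → ∀ v ∈ Box γ₀ k, b ≤ βI k v)
    (hlo : ∀ k, ∀ v ∈ Box γ₀ k, -β' ≤ βI k v) (hup : BetaUpperH β' γ₀ βI)
    (hcontI : BetaContH γ₀ βI) (hcontδ : BetaContH γ₀ δ)
    (hBγ : (b + β') * k₀ * γ₁ ^ 2 ≤ β₀ * (2 + β₀)) (hBγ' : (b + β') * k₀ * γ₁ ^ 2 ≤ 1 / 2) (hκ : 6 ≤ κ)
    (hsmall : Real.sqrt 2 ^ (κ - 6) * (2 * γ₁ ^ 4 / (b / 2) + γ₁ ^ 6) < 1)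
    (hcs : ∀ (F : Flow) (K : ℕ) (R : ℕ → ℕ), F.SatisfiesRG K → F.InInterval (min γ₀ γ₁) K →
      (∀ j, j ≤ K → B14.IsRj L p (F.g j) (R j)) →
      CondSmallFC F (β' + b / 2) β₀ A₀ L p κ R (fun k => δ k (prefixOf F.g k)) K (b / 2)) :
    ∀ (m : ℕ) (γ : ℝ), 0 < γ → γ ≤ min γ₀ γ₁ → ∀ g : ℝ, 0 < g → 1 / γ ^ 2 + (β' + b / 2) * k₀ ≤ 1 / g ^ 2 →
      ∀ K : ℕ, ∃ g0 : ℝ, (C ⟨K, m, g0⟩).flow.InInterval γ K ∧ (C ⟨K, m, g0⟩).flow.g K = g ∧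
        ∀ k, k ≤ K →
          1 / g ^ 2 + b / 2 * ((K : ℝ) - k) - (b + β') * k₀ ≤ 1 / ((C ⟨K, m, g0⟩).flow.g k) ^ 2 ∧
          1 / g ^ 2 - (β' + b / 2) * k₀ ≤ 1 / ((C ⟨K, m, g0⟩).flow.g k) ^ 2 ∧
          1 / ((C ⟨K, m, g0⟩).flow.g k) ^ 2 ≤ 1 / g ^ 2 + (β' + b / 2) * ((K : ℝ) - k) := by
  obtain ⟨βc, hcontc, hupc, hloc, htailc, hagree⟩ := exists_clamped hb hsplit htail hlo hup hcontI hcontδ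
  intro m γ hγ hγle g hg hgM K
  have hγγ₀ : γ ≤ γ₀ := hγle.trans (min_le_left _ _)
  have hγγ₁ : γ ≤ γ₁ := hγle.trans (min_le_right _ _)
  -- smallness at γ
  have Smγ : B14FlowStep.SmallnessFor γ (β' + b / 2) β₀ L p := smallnessFor_of_le Sm hγ hγγ₁
  have hBk : 0 ≤ (b + β') * (k₀ : ℝ) := by positivity
  have hBγγ : (b + β') * k₀ * γ ^ 2 ≤ β₀ * (2 + β₀) := defect_of_le hBk hγ.le hγγ₁ hBγ
  have hBγγ' : (b + β') * k₀ * γ ^ 2 ≤ 1 / 2 := defect_of_le hBk hγ.le hγγ₁ hBγ'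
  have hsmallγ := polySmall_of_le (half_pos hb) hγ.le hγγ₁ hsmall
  -- partial sums of the clamped family
  have hM : 0 ≤ (β' + b / 2) * (k₀ : ℝ) := by positivity
  have hβ'' : 0 ≤ β' + b / 2 := by positivity
  have hps : BetaPartialSumsLowerH ((β' + b / 2) * k₀) γ₀ βc :=
    betaPartialSumsLowerH_of_eventualLower (half_pos hb).le hβ'' htailc hloc
  -- shooting with the clamped family in ]0,γ]
  obtain ⟨gs, hgsK, hrgc, hIgs, -⟩ := couplingTrajectory_exists_partialSums βc hγ hM hβ''
    (fun k => (hcontc k).mono (box_mono hγγ₀ k)) (betaPartialSumsLowerH_mono hγγ₀ hps)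
    (fun k v hv => hupc k v (box_mono hγγ₀ k hv)) K g hg hgM
  -- the flow carrying the trajectory, with the clamped family curried along it
  obtain ⟨F, hFg, hFβ⟩ := exists_curriedFlow βc gs
  subst hFg
  have hreal : ∀ j, F.β (j + 1) (F.g j) = βc j (prefixOf F.g j) := by
    intro j; rw [hFβ, update_prefixOf_last]
  have hrgF : F.SatisfiesRG K := by
    intro k hk; rw [hreal]; exact hrgc k hk
  have hIF : F.InInterval γ K := hIgs
  have hbox : ∀ j, j ≤ K → prefixOf F.g j ∈ Box γ₀ j := by
    intro j hj
    exact mem_box.mpr fun i => by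
      have hi : (i : ℕ) ≤ K := by have := i.isLt; omega
      exact ⟨(hIgs i hi).1, (hIgs i hi).2.trans hγγ₀⟩
  -- realised bounds of the clamped family along the trajectory
  have hubF : ∀ j, j < K → F.β (j + 1) (F.g j) ≤ β' + b / 2 := fun j hj => by
    rw [hreal]; exact hupc j _ (hbox j hj.le)
  have hloF : ∀ j, j < K → -(β' + b / 2) ≤ F.β (j + 1) (F.g j) := fun j hj => by
    rw [hreal]; exact hloc j _ (hbox j hj.le)
  have htailF : ∀ j, k₀ ≤ j → j < K → b / 2 ≤ F.β (j + 1) (F.g j) := fun j hj0 hj => by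
    rw [hreal]; exact htailc j hj0 _ (hbox j hj.le)
  -- sizes, and the flow facts at every horizon from the clamped bounds alone (§1)
  choose R hR using fun j => B14FlowStep.isRj_exists Sm.hL p (F.g j)
  have hfacts : ∀ k, k ≤ K → HorizonFacts F (β' + b / 2) β₀ A₀ L p κ R k :=
    horizonFacts_of_realisedBounds F K Smγ hA₀ R (fun j _ => hR j) hrgF hIF hb hubF hloF htailF hBγγ hBγγ' hκ
      hsmallγ
  -- the conditional smallness fires: the clamp is inactive along the trajectory
  have hIF' : F.InInterval (min γ₀ γ₁) K := fun k hk => ⟨(hIgs k hk).1, (hIgs k hk).2.trans hγle⟩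
  have hδ : ∀ k, k < K → |δ k (prefixOf F.g k)| ≤ b / 2 := fun k hk =>
    hcs F K R hrgF hIF' (fun j _ => hR j) k hk (hfacts k hk.le)
  have hrgβ : RGEqH K β F.g := by
    intro k hk
    rw [← hagree k _ (hbox k hk.le) (hδ k hk)]
    exact hrgc k hk
  -- forward uniqueness: C's run from the same bare coupling IS this trajectory
  have heq : ∀ k, k ≤ K → (C ⟨K, m, F.g 0⟩).flow.g k = F.g k :=
    flow_eq_of_rgEqH (C ⟨K, m, F.g 0⟩).flow β K (fun k hk => hgen.2 ⟨K, m, F.g 0⟩ k hk)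
      (hgen.1 ⟨K, m, F.g 0⟩) hrgβ (fun k hk => (hIgs k hk).1)
  -- the defected two-sided running along the clamped (= actual) trajectory
  have hdef := defected031_of_eventualLower F K (half_pos hb).le hβ'' hrgF hloF hubF htailF
  refine ⟨F.g 0, fun k hk => ?_, ?_, fun k hk => ?_⟩
  · rw [heq k hk]; exact hIgs k hk
  · rw [heq K le_rfl]; exact hgsK
  · obtain ⟨h1, h2, h3⟩ := hdef k hk
    rw [hgsK] at h1 h2 h3
    rw [heq k hk]
    refine ⟨?_, h2, h3⟩
    have e : (b / 2 + (β' + b / 2)) * (k₀ : ℝ) = (b + β') * k₀ := by ring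
    rw [e] at h1
    exact h1

/-- **Endpoint existence under reading (α).**  Let `C` be generated forward by (0.20) with the realised family
`β = βᴵ + δ` (on the boxes `]0,γ₀]^{k+1}`), `βᴵ` carrying the eventual data (`≥ b > 0` for `k ≥ k₀`, `−β′ ≤ βᴵ ≤ β′`,
jointly continuous), `δ` jointly continuous on the boxes, and `δ` CONDITIONALLY small HISTORY-WISE: for every flow `F`
solving (0.20) in `]0, min(γ₀,γ₁)]` up to `K`, every admissible choice of sizes `R_j` (2.5), and every `k < K`, the
printed flow facts (2.6)–(2.9) ∧ (2.46) up to the horizon `k` imply `|δ_k(g_0,…,g_k)| ≤ b/2` (the interface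
`B14DeltaBeta.CondSmallFC` of the B14 §3 lineage, lifted from one run to histories — the lift is THIS MODULE'S READING of how
the lineage's reconstruction produces the bound, DIVERGENCE D-sb14.6; print asserts no bound at all).  Then, with ONE smallness threshold
`γ₁` (`SmallnessFor γ₁ (β′+b/2) β₀ L p`, `(b+β′)k₀γ₁² ≤ β₀(2+β₀) ∧ ≤ 1/2`, `(√2)^{κ−6}(4γ₁⁴/b + γ₁⁶) < 1`):
`DagBinding.EndpointExistence C` — for every `m`, every `γ ≤ min(γ₀,γ₁)`, every `g ≤ g⋆ = (1/γ² + (β′+b/2)k₀)^{−1/2}` and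
EVERY `K`, a bare coupling whose run stays in `]0,γ]` and ends at `g_K = g`.  PROOF (the clamp trick): shoot with the
clamped family `β̂` of `exists_clamped` (`FlowStepRuns.couplingTrajectory_exists_partialSums`: box-wide partial sums
`≥ −(β′+b/2)k₀`); along the resulting (0.20)-trajectory of `β̂` in `]0,γ]` the realised values obey the clamped bounds,
so §1 gives the flow facts at EVERY horizon; the conditional smallness fires, `|δ_k| ≤ b/2`, the clamp is inactive,
the trajectory solves (0.20) for `β` itself, and forward uniqueness (`FlowStepRuns.flow_eq_of_rgEqH`) identifies it
with `C`'s run from the same bare coupling.  No sign, no rate, no small-k list; every β-function input is the β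
sub-cell's eventual data on [I]'s family, every `δ`-input is the B14 §3 lineage's conditional display + continuity.
[cite: Balaban1987RG1, Thm 2 p.259 (first sentence) and (0.20) p.256] [cite: Balaban1988Convergent, p.259, p.271, p.278] -/
theorem endpointExistence_of_condSmallH {C : B12.Construction} {β βI δ : HBeta}
    (hgen : ForwardGenerated C β) {γ₀ : ℝ} (hγ₀ : 0 < γ₀)
    (hsplit : ∀ k, ∀ v ∈ Box γ₀ k, β k v = βI k v + δ k v)
    {γ₁ b β' β₀ A₀ : ℝ} {L p k₀ κ : ℕ} (Sm : B14FlowStep.SmallnessFor γ₁ (β' + b / 2) β₀ L p) (hA₀ : 0 ≤ A₀)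
    (hb : 0 < b) (hβ' : 0 ≤ β')
    (htail : ∀ k, k₀ ≤ k → ∀ v ∈ Box γ₀ k, b ≤ βI k v)
    (hlo : ∀ k, ∀ v ∈ Box γ₀ k, -β' ≤ βI k v) (hup : BetaUpperH β' γ₀ βI)
    (hcontI : BetaContH γ₀ βI) (hcontδ : BetaContH γ₀ δ)
    (hBγ : (b + β') * k₀ * γ₁ ^ 2 ≤ β₀ * (2 + β₀)) (hBγ' : (b + β') * k₀ * γ₁ ^ 2 ≤ 1 / 2) (hκ : 6 ≤ κ)
    (hsmall : Real.sqrt 2 ^ (κ - 6) * (2 * γ₁ ^ 4 / (b / 2) + γ₁ ^ 6) < 1)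
    (hcs : ∀ (F : Flow) (K : ℕ) (R : ℕ → ℕ), F.SatisfiesRG K → F.InInterval (min γ₀ γ₁) K →
      (∀ j, j ≤ K → B14.IsRj L p (F.g j) (R j)) →
      CondSmallFC F (β' + b / 2) β₀ A₀ L p κ R (fun k => δ k (prefixOf F.g k)) K (b / 2)) :
    EndpointExistence C := by
  intro m
  refine ⟨min γ₀ γ₁, lt_min hγ₀ Sm.γ_pos, fun γ hγ hγle => ?_⟩
  have hM : 0 ≤ (β' + b / 2) * (k₀ : ℝ) := by positivity
  set gstar : ℝ := 1 / Real.sqrt (1 / γ ^ 2 + (β' + b / 2) * k₀) with hgstar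
  have hgstar_pos : 0 < gstar := by positivity
  refine ⟨gstar, hgstar_pos, fun g hg hgle K => ?_⟩
  have hgs : 1 / gstar ^ 2 = 1 / γ ^ 2 + (β' + b / 2) * k₀ := by
    rw [hgstar, div_pow, one_pow, Real.sq_sqrt (by positivity), one_div_one_div]
  have hgM : 1 / γ ^ 2 + (β' + b / 2) * k₀ ≤ 1 / g ^ 2 := by
    rw [← hgs]; exact one_div_le_one_div_of_le (by positivity) (pow_le_pow_left₀ hg.le hgle 2)
  obtain ⟨g0, hI, hK, -⟩ := endpointRun_of_condSmallH hgen hsplit Sm hA₀ hb hβ' htail hlo hup hcontI hcontδ hBγ hBγ'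
    hκ hsmall hcs m γ hγ hγle g hg hgM K
  exact ⟨g0, hI, hK⟩

/-! ## 5. Both halves at once; the `EventualForm`-bundled forms; the (Δβ-a) grade as the source of the conditional
smallness -/

/-- **READING (α), END-STATEMENT GRADE — both halves.**  Under the hypotheses of `endpointExistence_of_condSmallH`
plus the two run-wise modelling clauses (`HaltsOutside`, `CurriesHBeta`) of `FlowStepRuns`: (i) `EndpointExistence C`,
and (ii) for every `γ ≤ min(γ₀,γ₁)` and every run of `C` staying in `]0,γ]` up to `K`, sizes `R_j` as in (2.5) exist
for which ALL of (2.6)–(2.9) (constant `β′+b/2`) and (2.46) hold at the horizon `K`.  So under reading (α) the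
END-statement-grade flow input is: the β sub-cell's eventual data on [I]'s family `βᴵ` (target `EventualForm`) + the
B14 §3 lineage's CONDITIONAL (Δβ) display + joint continuity of `δ` — and nothing else.
[cite: Balaban1987RG1, Thm 2 p.259] [cite: Balaban1988Convergent, (2.6)–(2.9) pp.255–256, (2.46) p.263] -/
theorem endpoint_and_flowControl_of_condSmallH {C : B12.Construction} {β βI δ : HBeta}
    (hgen : ForwardGenerated C β) (hhalt : HaltsOutside C β) (hcur : CurriesHBeta C β) {γ₀ : ℝ} (hγ₀ : 0 < γ₀)
    (hsplit : ∀ k, ∀ v ∈ Box γ₀ k, β k v = βI k v + δ k v)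
    {γ₁ b β' β₀ A₀ : ℝ} {L p k₀ κ : ℕ} (Sm : B14FlowStep.SmallnessFor γ₁ (β' + b / 2) β₀ L p) (hA₀ : 0 ≤ A₀)
    (hb : 0 < b) (hβ' : 0 ≤ β')
    (htail : ∀ k, k₀ ≤ k → ∀ v ∈ Box γ₀ k, b ≤ βI k v)
    (hlo : ∀ k, ∀ v ∈ Box γ₀ k, -β' ≤ βI k v) (hup : BetaUpperH β' γ₀ βI)
    (hcontI : BetaContH γ₀ βI) (hcontδ : BetaContH γ₀ δ)
    (hBγ : (b + β') * k₀ * γ₁ ^ 2 ≤ β₀ * (2 + β₀)) (hBγ' : (b + β') * k₀ * γ₁ ^ 2 ≤ 1 / 2) (hκ : 6 ≤ κ)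
    (hsmall : Real.sqrt 2 ^ (κ - 6) * (2 * γ₁ ^ 4 / (b / 2) + γ₁ ^ 6) < 1)
    (hcs : ∀ (F : Flow) (K : ℕ) (R : ℕ → ℕ), F.SatisfiesRG K → F.InInterval (min γ₀ γ₁) K →
      (∀ j, j ≤ K → B14.IsRj L p (F.g j) (R j)) →
      CondSmallFC F (β' + b / 2) β₀ A₀ L p κ R (fun k => δ k (prefixOf F.g k)) K (b / 2)) :
    EndpointExistence C ∧
      ∀ γ : ℝ, 0 < γ → γ ≤ min γ₀ γ₁ → ∀ P : B12.RunParams, (C P).flow.InInterval γ P.K →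
        ∃ R : ℕ → ℕ, (∀ j, B14.IsRj L p ((C P).flow.g j) (R j)) ∧
          HorizonFacts (C P).flow (β' + b / 2) β₀ A₀ L p κ R P.K := by
  refine ⟨endpointExistence_of_condSmallH hgen hγ₀ hsplit Sm hA₀ hb hβ' htail hlo hup hcontI hcontδ hBγ hBγ' hκ
    hsmall hcs, fun γ hγ hγle P hI => ?_⟩
  have hγγ₀ : γ ≤ γ₀ := hγle.trans (min_le_left _ _)
  have hγγ₁ : γ ≤ γ₁ := hγle.trans (min_le_right _ _)
  have Smγ : B14FlowStep.SmallnessFor γ (β' + b / 2) β₀ L p := smallnessFor_of_le Sm hγ hγγ₁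
  have hBk : 0 ≤ (b + β') * (k₀ : ℝ) := by positivity
  choose R hR using fun j => B14FlowStep.isRj_exists Sm.hL p ((C P).flow.g j)
  have hrg : (C P).flow.SatisfiesRG P.K := satisfiesRG_of_inInterval hgen hhalt hcur P hI
  have hI' : (C P).flow.InInterval (min γ₀ γ₁) P.K := fun k hk => ⟨(hI k hk).1, (hI k hk).2.trans hγle⟩
  exact ⟨R, hR, flowControl_along_of_condSmall hgen hhalt hcur hsplit Smγ hA₀ hγγ₀ hb hβ' htail hlo hup
    (defect_of_le hBk hγ.le hγγ₁ hBγ) (defect_of_le hBk hγ.le hγγ₁ hBγ') hκ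
    (polySmall_of_le (half_pos hb) hγ.le hγγ₁ hsmall) P hI R (fun j _ => hR j)
    (hcs (C P).flow P.K R hrg hI' (fun j _ => hR j))⟩

/-- **`EventualForm`-bundled**: the β sub-cell's END-statement-grade target for [I]'s family `βᴵ`
(`Beta.Assembly.EventualForm βI`: (EV-AF) + the printed two-sided bound + continuity) + the conditional (Δβ) display
history-wise + continuity of `δ` ⟹ both halves for the construction generated by the REALISED family `βᴵ + δ`.
[cite: Balaban1987RG1, Thm 2 p.259] [cite: Balaban1988Convergent, (2.6)–(2.9) pp.255–256, (2.46) p.263] -/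
theorem endpoint_and_flowControl_of_eventualForm {C : B12.Construction} {β βI δ : HBeta}
    (hgen : ForwardGenerated C β) (hhalt : HaltsOutside C β) (hcur : CurriesHBeta C β) (E : EventualForm βI)
    (hsplit : ∀ k, ∀ v ∈ Box E.γ₀ k, β k v = βI k v + δ k v) (hcontδ : BetaContH E.γ₀ δ)
    {γ₁ β₀ A₀ : ℝ} {L p κ : ℕ} (Sm : B14FlowStep.SmallnessFor γ₁ (E.β' + E.b / 2) β₀ L p) (hA₀ : 0 ≤ A₀)
    (hBγ : (E.b + E.β') * E.k₀ * γ₁ ^ 2 ≤ β₀ * (2 + β₀)) (hBγ' : (E.b + E.β') * E.k₀ * γ₁ ^ 2 ≤ 1 / 2)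
    (hκ : 6 ≤ κ) (hsmall : Real.sqrt 2 ^ (κ - 6) * (2 * γ₁ ^ 4 / (E.b / 2) + γ₁ ^ 6) < 1)
    (hcs : ∀ (F : Flow) (K : ℕ) (R : ℕ → ℕ), F.SatisfiesRG K → F.InInterval (min E.γ₀ γ₁) K →
      (∀ j, j ≤ K → B14.IsRj L p (F.g j) (R j)) →
      CondSmallFC F (E.β' + E.b / 2) β₀ A₀ L p κ R (fun k => δ k (prefixOf F.g k)) K (E.b / 2)) :
    EndpointExistence C ∧
      ∀ γ : ℝ, 0 < γ → γ ≤ min E.γ₀ γ₁ → ∀ P : B12.RunParams, (C P).flow.InInterval γ P.K →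
        ∃ R : ℕ → ℕ, (∀ j, B14.IsRj L p ((C P).flow.g j) (R j)) ∧
          HorizonFacts (C P).flow (E.β' + E.b / 2) β₀ A₀ L p κ R P.K :=
  endpoint_and_flowControl_of_condSmallH hgen hhalt hcur E.γ₀_pos hsplit Sm hA₀ E.b_pos E.β'_pos.le E.tail E.lower
    E.upper E.cont hcontδ hBγ hBγ' hκ hsmall hcs

/-- **The (Δβ-a) grade, history-wise, is a SOURCE of the conditional smallness with pure-γ smallness** (pv02's
`condSmallFC_of_boundA_pow` lifted to histories): if along every flow solving (0.20) in `]0,γ⋆]` (`γ⋆ ≤ 1`) the realised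
`δ` obeys (Δβ-a) `Σ_{j≤k} g_j^κ ≤ 1 ⟹ |δ_k| ≤ D_a Σ_{j≤k} g_j^κ` (`D_a ≥ 0`), and `D_a γ⋆^{κ−6} ≤ θ`, then the
history-wise `CondSmallFC` with threshold `θ` holds on `]0,γ⋆]` — (2.46) at the horizon bounds the layer sum by
`g_k^{κ−6} ≤ γ⋆^{κ−6}`.  NOT PRINTED: (Δβ-a) is the B14 §3 lineage's reconstruction (GAPS G-sb14-4 / G-B14s-23),
asserted by nobody; this is bookkeeping over its typed shape. [cite: Balaban1988Convergent, (2.46) p.263, p.278] -/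
theorem condSmallH_of_boundAH {δ : HBeta} {γs β'' β₀ A₀ θ Da : ℝ} {L p κ : ℕ} (hγs1 : γs ≤ 1) (hDa : 0 ≤ Da)
    (hDaγ : Da * γs ^ (κ - 6) ≤ θ)
    (hA : ∀ (F : Flow) (K : ℕ), F.SatisfiesRG K → F.InInterval γs K →
      DeltaBoundA F.g (fun k => δ k (prefixOf F.g k)) K κ Da) :
    ∀ (F : Flow) (K : ℕ) (R : ℕ → ℕ), F.SatisfiesRG K → F.InInterval γs K →
      (∀ j, j ≤ K → B14.IsRj L p (F.g j) (R j)) →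
      CondSmallFC F β'' β₀ A₀ L p κ R (fun k => δ k (prefixOf F.g k)) K θ :=
  fun F K _ hrg hI _ => condSmallFC_of_boundA_pow F K hI hγs1 hDa (hA F K hrg hI) hDaγ

/-- **Both halves from `EventualForm βᴵ` + the (Δβ-a) grade history-wise + continuity of `δ`, pure-γ smallness**
`D_a·(min(γ₀,γ₁))^{κ−6} ≤ b/2` (the side condition `min(γ₀,γ₁) ≤ 1` of `condSmallH_of_boundAH` holds silently through
`SmallnessFor γ₁ …`, which carries `γ₁ < 1`). [cite: Balaban1987RG1, Thm 2 p.259] [cite: Balaban1988Convergent, (2.6)–(2.9) pp.255–256, (2.46) p.263, p.278] -/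
theorem endpoint_and_flowControl_of_boundAH {C : B12.Construction} {β βI δ : HBeta}
    (hgen : ForwardGenerated C β) (hhalt : HaltsOutside C β) (hcur : CurriesHBeta C β) (E : EventualForm βI)
    (hsplit : ∀ k, ∀ v ∈ Box E.γ₀ k, β k v = βI k v + δ k v) (hcontδ : BetaContH E.γ₀ δ)
    {γ₁ β₀ A₀ Da : ℝ} {L p κ : ℕ} (Sm : B14FlowStep.SmallnessFor γ₁ (E.β' + E.b / 2) β₀ L p) (hA₀ : 0 ≤ A₀)
    (hBγ : (E.b + E.β') * E.k₀ * γ₁ ^ 2 ≤ β₀ * (2 + β₀)) (hBγ' : (E.b + E.β') * E.k₀ * γ₁ ^ 2 ≤ 1 / 2)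
    (hκ : 6 ≤ κ) (hsmall : Real.sqrt 2 ^ (κ - 6) * (2 * γ₁ ^ 4 / (E.b / 2) + γ₁ ^ 6) < 1)
    (hDa : 0 ≤ Da) (hDaγ : Da * (min E.γ₀ γ₁) ^ (κ - 6) ≤ E.b / 2)
    (hA : ∀ (F : Flow) (K : ℕ), F.SatisfiesRG K → F.InInterval (min E.γ₀ γ₁) K →
      DeltaBoundA F.g (fun k => δ k (prefixOf F.g k)) K κ Da) :
    EndpointExistence C ∧
      ∀ γ : ℝ, 0 < γ → γ ≤ min E.γ₀ γ₁ → ∀ P : B12.RunParams, (C P).flow.InInterval γ P.K →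
        ∃ R : ℕ → ℕ, (∀ j, B14.IsRj L p ((C P).flow.g j) (R j)) ∧
          HorizonFacts (C P).flow (E.β' + E.b / 2) β₀ A₀ L p κ R P.K :=
  endpoint_and_flowControl_of_eventualForm hgen hhalt hcur E hsplit hcontδ Sm hA₀ hBγ hBγ' hκ hsmall
    (condSmallH_of_boundAH ((min_le_right _ _).trans Sm.γ_lt_one.le) hDa hDaγ hA)

/-! ## 6. Non-vacuity and the unperturbed special case -/

/-- The hypothesis set of §4–§5 is inhabited: with `δ ≡ 0` the conditional smallness and the continuity of `δ` hold
trivially and the split is `β = βᴵ`; so the theorems above specialise to `Beta.Assembly.EventualForm.endpointExistence`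
/ `Beta.FlowConsumers.eventualForm_flowControl_along` (with the constant `β′+b/2` in place of `β′`). [folklore] -/
theorem condSmallH_of_zero {γs β'' β₀ A₀ θ : ℝ} {L p κ : ℕ} (hθ : 0 ≤ θ) :
    ∀ (F : Flow) (K : ℕ) (R : ℕ → ℕ), F.SatisfiesRG K → F.InInterval γs K →
      (∀ j, j ≤ K → B14.IsRj L p (F.g j) (R j)) →
      CondSmallFC F β'' β₀ A₀ L p κ R (fun _ => 0) K θ := by
  intro F K R _ _ _ k _ _
  simpa using hθ

/-- The unperturbed special case as a check of the quantifier shape: `EventualForm β` alone (δ ≡ 0) gives both halves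
through §5. [folklore] -/
theorem endpoint_and_flowControl_unperturbed {C : B12.Construction} {β : HBeta}
    (hgen : ForwardGenerated C β) (hhalt : HaltsOutside C β) (hcur : CurriesHBeta C β) (E : EventualForm β)
    {γ₁ β₀ A₀ : ℝ} {L p κ : ℕ} (Sm : B14FlowStep.SmallnessFor γ₁ (E.β' + E.b / 2) β₀ L p) (hA₀ : 0 ≤ A₀)
    (hBγ : (E.b + E.β') * E.k₀ * γ₁ ^ 2 ≤ β₀ * (2 + β₀)) (hBγ' : (E.b + E.β') * E.k₀ * γ₁ ^ 2 ≤ 1 / 2)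
    (hκ : 6 ≤ κ) (hsmall : Real.sqrt 2 ^ (κ - 6) * (2 * γ₁ ^ 4 / (E.b / 2) + γ₁ ^ 6) < 1) :
    EndpointExistence C ∧
      ∀ γ : ℝ, 0 < γ → γ ≤ min E.γ₀ γ₁ → ∀ P : B12.RunParams, (C P).flow.InInterval γ P.K →
        ∃ R : ℕ → ℕ, (∀ j, B14.IsRj L p ((C P).flow.g j) (R j)) ∧
          HorizonFacts (C P).flow (E.β' + E.b / 2) β₀ A₀ L p κ R P.K :=
  endpoint_and_flowControl_of_eventualForm (βI := β) (δ := fun _ _ => 0) hgen hhalt hcur E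
    (fun k v _ => by simp) (fun _ => continuousOn_const) Sm hA₀ hBγ hBγ' hκ hsmall
    (condSmallH_of_zero (half_pos E.b_pos).le)

end

end Literature.MathematicalPhysics.QuantumFieldTheory.Balaban1983to89.Beta.PerturbedFamily
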